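import Summits.CriticalPhenomena.PercolationContinuityZ3.Theorems.PercNearOneGluingNoHeavyQuantGatedShiftTransport
import Summits.CriticalPhenomena.PercolationContinuityZ3.Theorems.PercNearOneGluingNoHeavyQuantGatedConvCone
import Summits.CriticalPhenomena.PercolationContinuityZ3.Theorems.PercNearOneGluingNoHeavyQuantLawDecFlowsDecomposition
import HarnessLib

/-!
# QUANT lane R8, T-DEC: CONJECTURE R (`LawDec.GatedShiftDEC`, the gated shift / relay lemma) PROVED FOR LAWS WITH NO ATOM STRICTLY BETWEEN
# THEIR MEAN AND THEIR TOP (part 3 of 3; kernel, unconditional)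

builds on p205010 (kernel theorem, internal audit signed; external expert review pending)

Support file (`--supports stmt-CriticalPhenomena-4575`), QUANT lane typer seat prim-quant-stmt (gen 25), rung R8 of
`run/shared/lean/prim/quant/LADDER.md`; memo `run/shared/lean/prim/quant/prim-quant-stmt-g25/GATE-INTERACTION-G25.md` §4.  Theorems only, standard
axioms, no sorries.  Uses part 2 (`flowAtT_gatedShift`), the flow normal form (`flowAtT_of_decAtT`, `decAtT_of_flowAtT`, typer g22), criterion E
(`decAt_of_giantsAbsorbLows`, census-2 g52), `SDECUpTo` / `gate_laws` (typer g25) and `lconv_point_left` (`…QuantGatedConvCone`).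

THE THEOREM.  `0 < x ≤ 1`, `Q ≤ 1`, `Q·x < 1`, `k ≥ 1`; `μ ≥ 0` a law on `{0..M}` of mass `1`, top-affordable (`x·M ≤ T`, `T` the mean), with NO ATOM
STRICTLY BETWEEN `T` AND `M` (`μ h > 0 → h < M → h ≤ T`; e.g. every blob law `{0, a}`, every law concentrated below its mean plus one top atom).  If `μ`
is SDEC up to `Q` at `x` then so is the shifted law `μ(· − k)` = `lconv k M δ_k μ` on `{0..k+M}`: the conclusion of `LawDec.GatedShiftDEC` for this
class (`gatedShiftDEC_subMean`).  Layers `j < k`: only the gate mass `1 − q` lies at or below the layer and the giants carry `q ≥ qx` (criterion E).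
Layers `j ≥ k`: transport the flow of `gate μ q` at layer `j − k` (`flowAtT_gatedShift`; the stay condition `h·q ≤ q·T` is the sub-mean hypothesis,
the top `M` being a giant at every layer `j − k < M`).
HONEST STATUS: `GatedShiftDEC` in general (laws with mids above the mean: re-routing needed), `GatedConvEmptyFree`, `GatedConvClosedT`, `ConvClosedT`,
`SDECConvClosed` remain OPEN.

* `sum_Ico_eq_one_sub` — mass split at a layer.
* **`LawDec.gatedShift_sdecUpTo_subMean`** — the theorem for the shifted law `μ(· − k)`.
* **`LawDec.gatedShiftDEC_subMean`** — the same for `lconv k M δ_k μ`, literally the conclusion of `GatedShiftDEC`.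

[this work]; flow normal form / rates: this lane (typer g22, lead g21).  The gluing rows served [cite: KozmaNitzan2024, Conjecture 3 (p. 15)];
product measure [cite: Grimmett1999, §1.3 p. 10].
-/

noncomputable section

namespace Summit.CriticalPhenomena.PercolationContinuityZ3.Theorems

namespace Quant

open Finset

namespace LawDec

/-! ### Conjecture R for laws with no atom strictly between the mean and the top -/

/-- mass bookkeeping: a law on `{0..M}` of mass `1`, split at layer `j`. [folklore] -/
theorem sum_Ico_eq_one_sub (μ : ℕ → ℝ) (M j : ℕ) (hj : j ≤ M) (hμ1 : ∑ h ∈ Finset.range (M + 1), μ h = 1) :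
    ∑ h ∈ Finset.Ico (j + 1) (M + 1), μ h = 1 - ∑ h ∈ Finset.range (j + 1), μ h := by
  have := Finset.sum_range_add_sum_Ico μ (show j + 1 ≤ M + 1 by omega)
  linarith

/-- **CONJECTURE R FOR SUB-MEAN-SUPPORTED LAWS (kernel).**  `0 < x ≤ 1`, `0 < Q ≤ 1`, `Q·x < 1`, `k ≥ 1`; `μ ≥ 0` a law on `{0..M}` of mass `1`
with `x·M ≤ T` (`T` the mean) and NO ATOM STRICTLY BETWEEN `T` AND `M` (`μ h > 0 → h < M → h ≤ T`).  If `μ` is SDEC up to `Q` at `x` then so is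
the shifted law `μ(· − k)` on `{0..k+M}` — i.e. every gate `q ≤ Q` of "a root vertex carrying `k` sure relays above the forest `μ`" is DEC at every
layer at floor `q·x`.  Layers `< k`: criterion E (`decAt_of_giantsAbsorbLows`, `qx ≤ q`); layers `≥ k`: `flowAtT_gatedShift` on the flow of
`gate μ q` at layer `j − k` (the stay condition is the sub-mean hypothesis). [this work] -/
theorem gatedShift_sdecUpTo_subMean (x Q : ℝ) (k M : ℕ) (μ : ℕ → ℝ) (hx0 : 0 < x) (hx1 : x ≤ 1) (hQ1 : Q ≤ 1)
    (hQx : Q * x < 1) (hk : 1 ≤ k) (hμ0 : ∀ h, 0 ≤ μ h) (hμM : ∀ h, M < h → μ h = 0) (hμ1 : ∑ h ∈ Finset.range (M + 1), μ h = 1)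
    (hta : x * (M : ℝ) ≤ ∑ h ∈ Finset.range (M + 1), (h : ℝ) * μ h)
    (hsub : ∀ h, 0 < μ h → h < M → (h : ℝ) ≤ ∑ t ∈ Finset.range (M + 1), (t : ℝ) * μ t)
    (hS : SDECUpTo x Q M μ) :
    SDECUpTo x Q (k + M) (fun t => if k ≤ t then μ (t - k) else 0) := by
  intro q hq0 hqQ j hj
  set T : ℝ := ∑ t ∈ Finset.range (M + 1), (t : ℝ) * μ t with hT
  set y : ℝ := q * x with hy
  have hq1 : q ≤ 1 := hqQ.trans hQ1
  have hy0 : 0 < y := mul_pos hq0 hx0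
  have hy1 : y < 1 := lt_of_le_of_lt (mul_le_mul_of_nonneg_right hqQ hx0.le) hQx
  have hyq : y ≤ q := mul_le_of_le_one_right hq0.le hx1
  set sh : ℕ → ℝ := fun t => if k ≤ t then μ (t - k) else 0 with hsh
  set L : ℕ → ℝ := gate sh q with hL
  -- law facts of the shifted law and of `L`
  have s0 : ∀ t, 0 ≤ sh t := fun t => by simp only [hsh]; split_ifs; exacts [hμ0 _, le_rfl]
  have sM : ∀ t, k + M < t → sh t = 0 := fun t ht => by
    simp only [hsh]; split_ifs
    · exact hμM _ (by omega)
    · rfl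
  have reindex : ∀ g : ℕ → ℝ, ∑ t ∈ Finset.range (k + M + 1), (if k ≤ t then g (t - k) else 0) = ∑ h ∈ Finset.range (M + 1), g h := by
    intro g
    rw [show k + M + 1 = k + (M + 1) by omega, Finset.sum_range_add]
    rw [Finset.sum_eq_zero (fun t ht => if_neg (by have := Finset.mem_range.1 ht; omega)), zero_add]
    exact Finset.sum_congr rfl fun h _ => by rw [if_pos (by omega), Nat.add_sub_cancel_left]
  have s1 : ∑ t ∈ Finset.range (k + M + 1), sh t = 1 := by simp only [hsh]; rw [reindex, hμ1]
  have smean : ∑ t ∈ Finset.range (k + M + 1), (t : ℝ) * sh t = T + k := by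
    have e : ∀ t : ℕ, (t : ℝ) * sh t = (if k ≤ t then (((t - k : ℕ) : ℝ) + k) * μ (t - k) else 0) := by
      intro t; simp only [hsh]
      split_ifs with hkt
      · rw [show ((t - k : ℕ) : ℝ) + k = t by push_cast [Nat.cast_sub hkt]; ring]
      · rw [mul_zero]
    simp_rw [e]
    rw [reindex (fun h => ((h : ℝ) + k) * μ h)]
    simp only [add_mul]
    rw [Finset.sum_add_distrib, ← Finset.mul_sum, hμ1, mul_one]
  obtain ⟨L0, LM, L1⟩ := gate_laws (k + M) sh q hq0.le hq1 s0 sM s1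
  have Lmean : ∑ t ∈ Finset.range (k + M + 1), (t : ℝ) * L t = q * (T + k) := by rw [hL, sum_mul_gate, smean]
  rw [decAt_iff_decAtT, Lmean]
  by_cases hjk : j < k
  · -- layers below `k`: only the atom `0` lies at or below the layer; the giants carry `q`
    have hDEC : DECAt y j (k + M) L := by
      refine decAt_of_giantsAbsorbLows y j (k + M) L hj L0 LM L1 hy0 ?_
      have hbelow : ∑ h ∈ Finset.range (j + 1), L h = 1 - q := by
        rw [Finset.sum_eq_single 0]
        · rw [hL, gate_apply]; simp only [hsh, if_true]; rw [if_neg (by omega)]; ring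
        · intro t ht ht0
          rw [Finset.mem_range] at ht
          rw [hL, gate_apply]; simp only [hsh]; rw [if_neg (by omega), if_neg ht0]; ring
        · intro h0; exact absurd (Finset.mem_range.2 (Nat.succ_pos j)) h0
      have hlows : ∑ h ∈ Finset.range (j + 1), (if 2 * (h : ℝ) < ∑ t ∈ Finset.range (k + M + 1), (t : ℝ) * L t then L h else 0) ≤ 1 - q := by
        rw [← hbelow]
        exact Finset.sum_le_sum fun h _ => by split_ifs; exacts [le_rfl, L0 h]
      have hgiants : ∑ h ∈ Finset.Ico (j + 1) (k + M + 1), L h = q := by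
        rw [sum_Ico_eq_one_sub L (k + M) j (by omega) L1, hbelow]; ring
      rw [hgiants]
      have := mul_le_mul_of_nonneg_left hlows hy0.le
      nlinarith
    rwa [decAt_iff_decAtT, Lmean] at hDEC
  · -- layers `j ≥ k`: transport the flow of `gate μ q` at layer `j − k`
    obtain ⟨J, rfl⟩ : ∃ J, j = J + k := ⟨j - k, by omega⟩
    have hJM : J < M := by omega
    -- `M ≥ 1`, so `T > 0`
    have hTpos : 0 < T := by
      have hM : (1 : ℝ) ≤ M := by exact_mod_cast (show 1 ≤ M by omega)
      nlinarith
    set ν : ℕ → ℝ := gate μ q with hν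
    obtain ⟨n0, nM, n1⟩ := gate_laws M μ q hq0.le hq1 hμ0 hμM hμ1
    have nmean : ∑ t ∈ Finset.range (M + 1), (t : ℝ) * ν t = q * T := by rw [hν, sum_mul_gate]
    have hDECν : DECAtT y (q * T) J M ν := by
      have := hS q hq0 hqQ J hJM
      rwa [decAt_iff_decAtT, nmean] at this
    have hFν := flowAtT_of_decAtT y (q * T) J M ν hy0 hy1 hDECν
    have hstay : ∀ h, 0 < ν h → h ≤ J → q * T < (h : ℝ) → (h : ℝ) * q ≤ q * T := by
      intro h hνh hhJ hlt
      have hμh : 0 < μ h := by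
        rw [hν, gate_apply] at hνh
        have hh0 : h ≠ 0 := by rintro rfl; simp at hlt; linarith [mul_pos hq0 hTpos]
        rw [if_neg hh0, mul_zero, add_zero] at hνh
        exact pos_of_mul_pos_right hνh hq0.le
      have := hsub h hμh (by omega)
      nlinarith
    have hm : q * μ 0 ≤ ν 0 := by rw [hν, gate_apply]; simp only [if_true]; nlinarith
    have hF := flowAtT_gatedShift y (q * T) q (q * μ 0) J M k ν hy0 hy1 hq0 hq1 hk (mul_pos hq0 hTpos) n0
      (mul_nonneg hq0.le (hμ0 0)) hm hstay hFν
    -- the transported law is `L`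
    have hLeq : (fun t : ℕ => if t = 0 then ν 0 - q * μ 0 else if t = k then q * μ 0 else if k ≤ t then ν (t - k) else 0) = L := by
      funext t
      rw [hL, gate_apply]
      simp only [hsh, hν]
      by_cases ht0 : t = 0
      · subst ht0; simp only [if_true]; rw [if_neg (by omega), gate_apply]; simp
      · rw [if_neg ht0, if_neg ht0]
        by_cases htk : t = k
        · subst htk; rw [if_pos rfl, if_pos le_rfl, Nat.sub_self]; ring
        · rw [if_neg htk]
          by_cases hkt : k ≤ t
          · rw [if_pos hkt, if_pos hkt, gate_apply, if_neg (by omega)]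
          · rw [if_neg hkt, if_neg hkt]; ring
    rw [hLeq, show M + k = k + M by omega] at hF
    have hDEC := decAtT_of_flowAtT y (q * T + q * k) (J + k) (k + M) L hy0 hy1 LM L1 hF
    have e : q * (T + (k : ℝ)) = q * T + q * k := by ring
    rw [e]
    exact hDEC

/-- **Conjecture R (`GatedShiftDEC`) for sub-mean-supported laws, in its own vocabulary**: the law `lconv k M δ_k μ` is `μ(· − k)`
(`lconv_point_left`), so `gatedShift_sdecUpTo_subMean` is the conclusion of `LawDec.GatedShiftDEC` under the extra hypothesis
"no atom strictly between the mean and the top". [this work] -/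
theorem gatedShiftDEC_subMean (x Q : ℝ) (k M : ℕ) (μ : ℕ → ℝ) (hx0 : 0 < x) (hx1 : x ≤ 1) (hQ1 : Q ≤ 1)
    (hQx : Q * x < 1) (hk : 1 ≤ k) (hμ0 : ∀ h, 0 ≤ μ h) (hμM : ∀ h, M < h → μ h = 0) (hμ1 : ∑ h ∈ Finset.range (M + 1), μ h = 1)
    (hta : x * (M : ℝ) ≤ ∑ h ∈ Finset.range (M + 1), (h : ℝ) * μ h)
    (hsub : ∀ h, 0 < μ h → h < M → (h : ℝ) ≤ ∑ t ∈ Finset.range (M + 1), (t : ℝ) * μ t)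
    (hS : SDECUpTo x Q M μ) :
    SDECUpTo x Q (k + M) (lconv k M (fun i => if i = k then (1 : ℝ) else 0) μ) := by
  have e : lconv k M (fun i => if i = k then (1 : ℝ) else 0) μ = fun t => if k ≤ t then μ (t - k) else 0 :=
    funext fun t => lconv_point_left k M μ hμM t
  rw [e]
  exact gatedShift_sdecUpTo_subMean x Q k M μ hx0 hx1 hQ1 hQx hk hμ0 hμM hμ1 hta hsub hS

end LawDec

end Quant

end Summit.CriticalPhenomena.PercolationContinuityZ3.Theorems
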